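/-
Copyright (c) 2026 the pub-hodgecm-mathlib formalisation cell (harness21).  Prover seat hodgecm-mathlib-K2Liu-p23 (g4), Track B «K2-LIT»,
#184♮ = hLiu418 = `stmt-HodgeConjecture-24832`; K1-a♮ `hGnb` road, FILE C ED. 3 — PART 2 (K1a desk WORDS #16∕#21∕#28∕#37∕#39 «T₀-SPLIT», hGnb desk WORDS #1–#2, 2026-09-05):
THE LOC-FACE LETTERS `Gn hGn hW` AT THE RECORD **WITH THE GROWTH LETTER `hGnv`**, assembled from TWO witness-free per-place growth letters —
(P-good) uniform off a finite set of places, (P-bad) per place — by the T₀-SPLIT (finite max over the bad places, the hyperspecial compact off them).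
KERNEL: theorems only (no `def`, no `instance`, no notation, no named-fact hypothesis, no `sorry`); lane `--supports stmt-HodgeConjecture-24832 --as helper`.
-/
import Summits.HodgeConjecture.HodgeConjecture.Theorems.K2LiuKindOneSingularLocalFaceOfRecordEdTwo      -- ★ ED. 2 p865136 (this lineage): brings ★ FILE B ED.1, ★ FILE D, ★ FILE A′, ★ p863501, ★ (β) frame
import Summits.HodgeConjecture.HodgeConjecture.Theorems.K2LiuKindOneSingularLocalFaceSigmaUniform       -- PART 1 (this seat): `exists_face_sigmaUniform_of_monomialFlat`, §1 `exists_pos_le_one_forall_le`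
import Summits.HodgeConjecture.HodgeConjecture.Theorems.K2LiuKindOneSingularLocalFaceGrowth            -- ★ p864748 (K2E3-p26): the `hGnv` currency (`GLn.localHeight`, ★ `GLn.one_le_localHeight`)
import Summits.HodgeConjecture.HodgeConjecture.Theorems.K2LiuSWGeneratorGoodPlaces                    -- ★ `eventually_forall_exists_siegelDelta_mul_localInt` (the cofinite Iwasawa set `T₃`)
import HarnessLib

/-!
# Crux `HLiu418`, socket #41, KIND 1 a♮ — FILE C ED. 3, PART 2: THE LOC-FACE LETTERS AT THE RECORD WITH THE GROWTH LETTER `hGnv` (T₀-SPLIT ASSEMBLY)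

Cell `hodgecm-mathlib`, crux item hLiu418 = `stmt-HodgeConjecture-24832` (helper lane `--supports … --as helper`, count-neutral), route of record
`HCCMUnconditional`; squad K2 ∕ K2Liu, socket #41 `sig_K2LiuSiegelEisensteinContinuation`, KIND 1, block K1-a♮; K1a desks K2Liu-p01 (g11) → K2E4-p10 (g11) ∕ hGnb desk
K2Liu-p23 (g4).  Consumer: ★ p864641 `K2LiuKindOneSingularFiniteHeadBound.hGnb_of_placeBounds`, whose binder `hGnv` :126–:131 is this file's third conclusion VERBATIM
(`I := fun _ _ => Finset.univ`).

WHY A NEW EDITION.  ★ ED. 2 `locFace_letters_of_record₂` (p865136) gives `(Gn, hGn, hW)`.  The finite-head size letter `hGnb` needs IN ADDITION the growth letter `hGnv`: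
`‖Gn S i v s h‖ ≤ (q_v^{mτ S v + 1} · ∏_{w∣v} H_w(gc S·h))^{Mv}` near every `z` with `0 < re z`, with ONE exponent `Mv` for ALL places `v ∈ T S h` — and `T S h ⊇ {v ∣ (gc S·h)_v ∉ K_{H,v}}`
(★ `kindWPlaces`) sweeps every finite place as `h` varies.  A per-place producer yields an ∃-exponent depending on the place data `(K₀(v), pieces, χ_v, ψ_v)`; a `sup` over
all `v` of ∃-exponents is not a number.  THE T₀-SPLIT (K1a desk WORD #39 (2), hGnb desk census `HN2-CENSUS.md`): off the finite set `S₀ ∪ T₃ ∪ Tg` the place data have ONE shape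
— the section is the spherical `Λ_{s,v}` (★ `LambdaLoc`, `χ_v` unramified), the Iwasawa compact is the hyperspecial `K_{H,v}` (★ `UnitaryGroup.localInt`; Iwasawa by ★
`eventually_forall_exists_siegelDelta_mul_localInt` off `T₃`), on which `Λ` is FLAT ITSELF (★ FILE A′ (f5) `Hf = 1` on `K_{H,v}`) — so ONE uniform letter (P-good) serves them
all; the finitely many places of `S₀ ∪ T₃ ∪ Tg` are served by PART 1 `exists_face_sigmaUniform_of_monomialFlat` (FILE D's compact open Iwasawa `K₁(v)`, ★ FILE B ED.1's σ-free
pieces, ★ p863501 per (piece, σ), the per-place letter (P-bad), one exponent per place), and the exponents are glued by a finite `max`.  BOTH LETTERS ARE WITNESS-FREE: they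
quantify over «every `Gn` with ★ p863501's two clauses (G1)(G2)» (that continuation is unique on `{0 < re}`, ★ `IsQRationalRegularAt.eq_of_eqOn_halfPlane`), so the socket
ties can instantiate them and independent files pay them: (P-good) ← the good-place translate reduction over ★ `K2LiuKindOneSingularLocalFaceGoodPlace.
exists_finset_forall_localFace_goodPlace_of_record` (hGnb desk DEAL A); (P-bad) ← the ball-letters road U-0∕U-1∕U-2∕(α) (LH4-p07 (g12)) + ★ p864748's algebra per place.

* HEAD **`locFace_letters_of_record₃`**: ★ ED. 2's binders + `(mτ) (hmτ)` ((A) (h5) of ★ p864217) + `(hPgood) (hPbad)` ⊢ `∃ Gn, hGn ∧ hW ∧ hGnv`.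
[KudlaRallis1994, §2], [KudlaSweet1997, §1], [HarrisKudlaSweet1996, §1 (1.15), §6 (6.14)–(6.16)], [Casselman1980, §3 Thm. 3.1], [Tan1999, §1, §3], [BorelJacquet1979, §1.2],
[MoeglinWaldspurger1995, I.2.2].

HONEST LABEL.  Count-neutral helper; it closes no socket by itself: `HC_CM` is proved only modulo the 7 printed citations (2 remaining named inputs: hLiu418 =
`stmt-HodgeConjecture-24832`, h413 = `stmt-HodgeConjecture-24833`) until rung 0 closes.  RESIDUAL LETTERS: the two growth letters `hPgood`, `hPbad` (witness-free, named
payers above) plus ★ ED. 2's own by-value inputs (`hb`, the corner datum `σc hτ gc T W hWeq`, `h𝒦`).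

## References
* [KudlaRallis1994] S. Kudla, S. Rallis, *A regularized Siegel–Weil formula: the first term identity*, Ann. of Math. 140 (1994): §2.
* [KudlaSweet1997] S. Kudla, W. J. Sweet, *Degenerate principal series representations for U(n,n)*, Israel J. Math. 98 (1997): §1.
* [HarrisKudlaSweet1996] M. Harris, S. Kudla, W. J. Sweet, J. AMS 9 (1996): §1 (1.15), §6 (6.14)–(6.16).
* [Casselman1980] W. Casselman, *The unramified principal series of p-adic groups I*, Compositio Math. 40 (1980): §3 Thm. 3.1.
* [Tan1999] V. Tan, *Poles of Siegel Eisenstein series on U(n,n)*, Canad. J. Math. 51 (1999): §1, §3.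
* [BorelJacquet1979] A. Borel, H. Jacquet, Proc. Sympos. Pure Math. 33.1 (1979): §1.2 (local heights).
* [MoeglinWaldspurger1995] C. Mœglin, J.-L. Waldspurger, *Spectral decomposition and Eisenstein series*, CUP (1995): I.2.2.
-/

set_option autoImplicit false
-- the mandated namespace repeats the single-problem summit's segment (`HodgeConjecture.HodgeConjecture`)
set_option linter.dupNamespace false

open scoped Matrix NNReal ENNReal ComplexConjugate
open NumberField IsDedekindDomain MeasureTheory Topology
open Literature.NumberTheory.GaloisRepresentations.IsNonarchimedeanLocalField
open Literature.NumberTheory.Automorphic Literature.NumberTheory.Automorphic.UnitaryGroup Literature.NumberTheory.GaloisRepresentations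
open Literature.NumberTheory.GelbartRogawski1991 Literature.NumberTheory.GelbartRogawski1991.GRConstruction
open Literature.NumberTheory.GelbartRogawski1991.UnitaryDualPair Literature.NumberTheory.GelbartRogawski1991.UnitaryDualPair.LocalSplitting
open Literature.NumberTheory.K2Lit Literature.NumberTheory.K2Lit.SiegelDoubled Literature.NumberTheory.K2Lit.LocalSiegelDoubled
open Summit.HodgeConjecture.HodgeConjecture.Cruxes.HLiu418.K2LiuQRationalDefs
open Summit.HodgeConjecture.HodgeConjecture.Cruxes.HLiu418.K2LiuSiegelUnipotentLocalDefs (unipDeltaLoc)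
open Summit.HodgeConjecture.HodgeConjecture.Cruxes.HLiu418.K2LiuSiegelUnipotentFourierDefs
open Summit.HodgeConjecture.HodgeConjecture.Cruxes.HLiu418.K2LiuSiegelUnipotentCharacters
open Summit.HodgeConjecture.HodgeConjecture.Cruxes.HLiu418.K2LiuKindOneSingularLocalFace (exists_localFace_kindOneSingular)
open Summit.HodgeConjecture.HodgeConjecture.Cruxes.HLiu418.K2LiuKindOneSingularLocalFaceSigmaUniform (exists_pos_le_one_forall_le exists_face_sigmaUniform_of_monomialFlat)
open Summit.HodgeConjecture.HodgeConjecture.Cruxes.HLiu418.K2LiuLocalIwasawaCompact (exists_isCompact_isOpen_iwasawa_cm)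
open Summit.HodgeConjecture.HodgeConjecture.Cruxes.HLiu418.K2LiuStdFamilyAwayPurityFlat (heightLoc_mul_of_mem isOpen_coe_comap_locToAdelic)
open Summit.HodgeConjecture.HodgeConjecture.Cruxes.HLiu418.K2LiuIwasawaHeightLocalModulus (exists_heightLoc_sq_eq_qpow)
open Summit.HodgeConjecture.HodgeConjecture.Cruxes.HLiu418.K2LiuSiegelModulusCompact (heightLoc_siegel_mul_of_isSiegelDelta_of_mem_compact)
open Summit.HodgeConjecture.HodgeConjecture.Cruxes.HLiu418.K2LiuLambdaLocHeightReading (exists_height_lambdaLoc_reading')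
open Summit.HodgeConjecture.HodgeConjecture.Cruxes.HLiu418.K2LiuSWGeneratorGoodPlaces (eventually_forall_exists_siegelDelta_mul_localInt)

namespace Summit.HodgeConjecture.HodgeConjecture.Cruxes.HLiu418.K2LiuKindOneSingularLocalFaceOfRecordEdThree

/-! ## HEAD: the LOC-FACE letters at the record with the growth letter `hGnv`, by the T₀-split -/

section Head

variable (L : Type) [Field L] [NumberField L] [IsCMField L] {N M : ℕ} (e : Fin N × Fin M ≃ Fin 2)
  (dV : Fin N → L) (hdV : ∀ i, IsCMField.complexConj L (dV i) = dV i) (hdV0 : ∀ i, dV i ≠ 0)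
  (dW : Fin M → L) (hdW : ∀ i, IsCMField.complexConj L (dW i) = dW i) (hdW0 : ∀ i, dW i ≠ 0)

set_option maxHeartbeats 1600000 in -- the ★ p863501 ∕ ★ FILE B ED.1 telescope class (`localPi (F := Fp L)` contacts), several applications per branch; measured at home
include hdV0 hdW0 in
/-- **FILE C ED. 3 — THE LOC-FACE LETTERS AT THE RECORD WITH THE GROWTH LETTER `hGnv` (T₀-SPLIT ASSEMBLY).**  Binders = ★ ED. 2 `locFace_letters_of_record₂` VERBATIM, plus the
conductor exponents `(mτ) (hmτ)` of ★ p864217 (A) (h5), plus TWO WITNESS-FREE GROWTH LETTERS: `hPgood` — off a finite set `Tg` of places, ONE exponent `M(z)` bounds EVERY regular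
continuation `Gn` (★ p863501's clauses (G1)(G2)) of the twisted local face of the spherical section `Λ_{s,v}` at every translate: `‖Gn s (h)_v‖ ≤ (q_v^{ordτ_v(σ)+1}·∏_{w∣v} H_w(h))^{M}`
near `z`; `hPbad` — at ANY place, for ANY compact open Iwasawa `K₀` and ANY `K₀`-flat family `F` of smooth Siegel sections of weight `χ_v`, SOME exponent does the same.  Conclusion:
★ p864235's LOC-FACE letters `(Gn, hGn, hW)` VERBATIM ∧ ★ p864641's `hGnv` :126–:131 VERBATIM (`I := fun _ _ => Finset.univ`).  Proof: off `S₀ ∪ T₃ ∪ Tg` the face of `Λ` at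
`K₀ := K_{H,v}` (★ p863501; `Λ` is `K_{H,v}`-flat by ★ FILE A′ (f5)) bounded by `hPgood`; on it, FILE D's `K₁(v)`, ★ FILE B ED.1's σ-free pieces, ★ p863501 per (piece, σ), `hPbad`
per piece, the labels' monomials by ★ FILE B ED.2 §1, and a finite `max` of exponents ∕ `min` of radii.
[cite: KudlaRallis1994, §2] [cite: KudlaSweet1997, §1] [cite: HarrisKudlaSweet1996, §1 (1.15), §6 (6.14)–(6.16)] [cite: Casselman1980, §3 Thm. 3.1] [cite: Tan1999, §1] [cite: BorelJacquet1979, §1.2] [cite: MoeglinWaldspurger1995, I.2.2] -/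
theorem locFace_letters_of_record₃ [DecidableEq (HeightOneSpectrum (𝓞 (Fp L)))]
    [∀ v : HeightOneSpectrum (𝓞 (Fp L)), MeasurableSpace ↥(unipDeltaLoc L e dV hdV dW hdW v)] [∀ v : HeightOneSpectrum (𝓞 (Fp L)), BorelSpace ↥(unipDeltaLoc L e dV hdV dW hdW v)]
    (νv : ∀ v : HeightOneSpectrum (𝓞 (Fp L)), Measure ↥(unipDeltaLoc L e dV hdV dW hdW v)) [∀ v, (νv v).IsHaarMeasure]
    {χ : HeckeCharacter L} (hχu : χ.IsUnitary) (𝒦 : IwasawaDatum L e dV hdV dW hdW) (h𝒦 : 𝒦.IsStd) (s₀ : ℂ)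
    {S₀ : Finset (HeightOneSpectrum (𝓞 (Fp L)))} (hχS₀ : ∀ v, v ∉ S₀ → ∀ w : UnitaryGroup.PlacesOver L v, χ.IsUnramifiedAt w.1) {m : ℕ}
    (b : Fin m → (v : HeightOneSpectrum (𝓞 (Fp L))) → (UnitaryGroup.localPi L (IsCMField.complexConj L) (2 + 2) (hermD L e dV hdV dW hdW) v → ℂ))
    (hb : ∀ i, ∀ v ∈ S₀, ∀ s : ℂ, (fun u => ((modDelta L e dV hdV dW hdW (𝒦.pPart (locToAdelic L e dV hdV dW hdW v u)) : ℝ) : ℂ) ^ (2 * (s - s₀)) * b i v u) ∈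
      localDegPS (Fp L) L (IsCMField.complexConj L) (complexConj_imagUnit L) (imagUnit_ne_zero L) (imagUnit_mul_self L)
        v 2 (gramR_isSymm L e dV hdV dW hdW) (hermD_eq_map_gramD L e dV hdV dW hdW) (fun w => χ.localComponent w.1) s)
    -- ★ p863805's corner datum BY VALUE (as ★ ED. 2)
    (σc : skewMatrices ((IsCMField.complexConj L : L ≃ₐ[Fp L] L) : L →+* L) ((gramR L e dV hdV dW hdW).map (algebraMap (Fp L) L)) → L)
    (hτ : ∀ S : skewMatrices ((IsCMField.complexConj L : L ≃ₐ[Fp L] L) : L →+* L) ((gramR L e dV hdV dW hdW).map (algebraMap (Fp L) L)),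
      (S : Matrix (Fin 2) (Fin 2) L) ≠ 0 → (S : Matrix (Fin 2) (Fin 2) L).det = 0 → gramR L e dV hdV dW hdW 1 1 * Algebra.trace (Fp L) L (σc S * imagUnit L) ≠ 0)
    (gc : skewMatrices ((IsCMField.complexConj L : L ≃ₐ[Fp L] L) : L →+* L) ((gramR L e dV hdV dW hdW).map (algebraMap (Fp L) L)) → HA L e dV hdV dW hdW)
    (T : skewMatrices ((IsCMField.complexConj L : L ≃ₐ[Fp L] L) : L →+* L) ((gramR L e dV hdV dW hdW).map (algebraMap (Fp L) L)) → HA L e dV hdV dW hdW →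
      Finset (HeightOneSpectrum (𝓞 (Fp L))))
    (W : skewMatrices ((IsCMField.complexConj L : L ≃ₐ[Fp L] L) : L →+* L) ((gramR L e dV hdV dW hdW).map (algebraMap (Fp L) L)) → Fin m →
      HeightOneSpectrum (𝓞 (Fp L)) → ℂ → HA L e dV hdV dW hdW → ℂ)
    (hWeq : ∀ (S : skewMatrices ((IsCMField.complexConj L : L ≃ₐ[Fp L] L) : L →+* L) ((gramR L e dV hdV dW hdW).map (algebraMap (Fp L) L))) (j : Fin m)
      (v : HeightOneSpectrum (𝓞 (Fp L))) (s : ℂ) (h : HA L e dV hdV dW hdW),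
      W S j v s h = ∫ y, conj (unipDeltaChar L e dV hdV dW hdW (Matrix.single 1 1 (σc S))
          (locToAdelic L e dV hdV dW hdW v (y : UnitaryGroup.localPi L (IsCMField.complexConj L) (2 + 2) (hermD L e dV hdV dW hdW) v)) : ℂ) *
        (fun (j : Fin m) (v : HeightOneSpectrum (𝓞 (Fp L))) (s : ℂ) (y : UnitaryGroup.localPi L (IsCMField.complexConj L) (2 + 2) (hermD L e dV hdV dW hdW) v) =>
            if v ∈ S₀ then ((modDelta L e dV hdV dW hdW (𝒦.pPart (locToAdelic L e dV hdV dW hdW v y)) : ℝ) : ℂ) ^ (2 * (s - s₀)) * b j v y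
            else LambdaLoc L e dV hdV dW hdW v χ s y) j v s
          (UnitaryGroup.evalPlace (Fp L) L (IsCMField.complexConj L) (2 + 2) (hermD L e dV hdV dW hdW) v
              (UnitaryGroup.finPart (Fp L) L (IsCMField.complexConj L) (2 + 2) (hermD L e dV hdV dW hdW) (weylDelta L e dV hdV dW hdW)) *
            (y : UnitaryGroup.localPi L (IsCMField.complexConj L) (2 + 2) (hermD L e dV hdV dW hdW) v) *
            UnitaryGroup.evalPlace (Fp L) L (IsCMField.complexConj L) (2 + 2) (hermD L e dV hdV dW hdW) v
              (UnitaryGroup.finPart (Fp L) L (IsCMField.complexConj L) (2 + 2) (hermD L e dV hdV dW hdW) (gc S * h))) ∂(νv v))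
    -- ★ p864217 (A) (h5): the conductor exponents of the corner twist `τ = g₁₁·Tr(σ·δ)`
    (mτ : skewMatrices ((IsCMField.complexConj L : L ≃ₐ[Fp L] L) : L →+* L) ((gramR L e dV hdV dW hdW).map (algebraMap (Fp L) L)) → HeightOneSpectrum (𝓞 (Fp L)) → ℕ)
    (hmτ : ∀ S (v : HeightOneSpectrum (𝓞 (Fp L))),
      mτ S v = (-WithZero.log (Valued.v (algebraMap (Fp L) (v.adicCompletion (Fp L)) (gramR L e dV hdV dW hdW 1 1 * Algebra.trace (Fp L) L (σc S * imagUnit L))))).toNat)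
    -- (P-good): THE UNIFORM GROWTH LETTER OFF A FINITE SET OF PLACES (spherical section, every translate, every regular continuation), WITNESS-FREE
    (hPgood : ∃ Tg : Finset (HeightOneSpectrum (𝓞 (Fp L))), ∀ z : ℂ, 0 < z.re → ∃ (Mg : ℕ) (rg : ℝ), 0 < rg ∧
      ∀ v, v ∉ Tg → ∀ σ : L, gramR L e dV hdV dW hdW 1 1 * Algebra.trace (Fp L) L (σ * imagUnit L) ≠ 0 →
      ∀ Gn : ℂ → UnitaryGroup.localPi L (IsCMField.complexConj L) (2 + 2) (hermD L e dV hdV dW hdW) v → ℂ,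
        (∀ s₁ : ℂ, 0 < s₁.re → ∀ x, IsQRationalRegularAt (residueFieldCard (v.adicCompletion (Fp L))) s₁ (fun s => Gn s x)) →
        (∀ s : ℂ, 1 < s.re → ∀ x : UnitaryGroup.localPi L (IsCMField.complexConj L) (2 + 2) (hermD L e dV hdV dW hdW) v,
          ∫ y : ↥(unipDeltaLoc L e dV hdV dW hdW v), conj ((unipDeltaChar L e dV hdV dW hdW (Matrix.single 1 1 σ)
                (locToAdelic L e dV hdV dW hdW v (y : UnitaryGroup.localPi L (IsCMField.complexConj L) (2 + 2) (hermD L e dV hdV dW hdW) v)) : ℂ)) *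
              LambdaLoc L e dV hdV dW hdW v χ s (UnitaryGroup.evalPlace (Fp L) L (IsCMField.complexConj L) (2 + 2) (hermD L e dV hdV dW hdW) v
                    (UnitaryGroup.finPart (Fp L) L (IsCMField.complexConj L) (2 + 2) (hermD L e dV hdV dW hdW) (SiegelDoubled.weylDelta L e dV hdV dW hdW)) *
                (y : UnitaryGroup.localPi L (IsCMField.complexConj L) (2 + 2) (hermD L e dV hdV dW hdW) v) * x) ∂(νv v) = Gn s x) →
        ∀ s : ℂ, dist s z < rg → ∀ h : HA L e dV hdV dW hdW,
          ‖Gn s (UnitaryGroup.evalPlace (Fp L) L (IsCMField.complexConj L) (2 + 2) (hermD L e dV hdV dW hdW) v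
              (UnitaryGroup.finPart (Fp L) L (IsCMField.complexConj L) (2 + 2) (hermD L e dV hdV dW hdW) h))‖ ≤
            ((((v.residueCard : ℕ) : ℝ) ^ ((-WithZero.log (Valued.v (algebraMap (Fp L) (v.adicCompletion (Fp L))
                (gramR L e dV hdV dW hdW 1 1 * Algebra.trace (Fp L) L (σ * imagUnit L))))).toNat + 1)) *
              ∏ w' : UnitaryGroup.PlacesOver L v, (GLn.localHeight (2 + 2) L w'.1 ((h : HA L e dV hdV dW hdW) : GL (Fin (2 + 2)) (AdeleRing (𝓞 L) L)) : ℝ)) ^ Mg)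
    -- (P-bad): THE PER-PLACE GROWTH LETTER (any place, any compact open Iwasawa `K₀`, any `K₀`-flat family of smooth Siegel sections of weight `χ_v`), WITNESS-FREE
    (hPbad : ∀ (v : HeightOneSpectrum (𝓞 (Fp L))) (K₀ : Subgroup (UnitaryGroup.localPi L (IsCMField.complexConj L) (2 + 2) (hermD L e dV hdV dW hdW) v)),
      IsCompact (K₀ : Set (UnitaryGroup.localPi L (IsCMField.complexConj L) (2 + 2) (hermD L e dV hdV dW hdW) v)) ∧
        IsOpen (K₀ : Set (UnitaryGroup.localPi L (IsCMField.complexConj L) (2 + 2) (hermD L e dV hdV dW hdW) v)) →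
      (haveI : Algebra.IsQuadraticExtension (Fp L) L := IsCMField.isQuadraticExtension L
        ∀ g : UnitaryGroup.localPi L (IsCMField.complexConj L) (2 + 2) (hermD L e dV hdV dW hdW) v,
          ∃ p, IsSiegelDelta (Fp L) L (IsCMField.complexConj L) (complexConj_imagUnit L) (imagUnit_ne_zero L) (imagUnit_mul_self L)
            v 2 (gramR_isSymm L e dV hdV dW hdW) (hermD_eq_map_gramD L e dV hdV dW hdW) p ∧ ∃ k ∈ K₀, g = p * k) →
      ∀ F : ℂ → UnitaryGroup.localPi L (IsCMField.complexConj L) (2 + 2) (hermD L e dV hdV dW hdW) v → ℂ,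
      (haveI : Algebra.IsQuadraticExtension (Fp L) L := IsCMField.isQuadraticExtension L
        ∀ s, IsLocalSiegelSection (Fp L) L (IsCMField.complexConj L) (complexConj_imagUnit L) (imagUnit_ne_zero L) (imagUnit_mul_self L)
          v 2 (gramR_isSymm L e dV hdV dW hdW) (hermD_eq_map_gramD L e dV hdV dW hdW) (fun w => χ.localComponent w.1) s (F s)) →
      (∀ s, IsSmooth (Fp L) L (IsCMField.complexConj L) v 2 (F s)) →
      (∀ s s' : ℂ, ∀ k ∈ K₀, F s k = F s' k) →
      ∀ z : ℂ, 0 < z.re → ∃ (Mb : ℕ) (rb : ℝ), 0 < rb ∧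
      ∀ σ : L, gramR L e dV hdV dW hdW 1 1 * Algebra.trace (Fp L) L (σ * imagUnit L) ≠ 0 →
      ∀ Gn : ℂ → UnitaryGroup.localPi L (IsCMField.complexConj L) (2 + 2) (hermD L e dV hdV dW hdW) v → ℂ,
        (∀ s₁ : ℂ, 0 < s₁.re → ∀ x, IsQRationalRegularAt (residueFieldCard (v.adicCompletion (Fp L))) s₁ (fun s => Gn s x)) →
        (∀ s : ℂ, 1 < s.re → ∀ x : UnitaryGroup.localPi L (IsCMField.complexConj L) (2 + 2) (hermD L e dV hdV dW hdW) v,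
          ∫ y : ↥(unipDeltaLoc L e dV hdV dW hdW v), conj ((unipDeltaChar L e dV hdV dW hdW (Matrix.single 1 1 σ)
                (locToAdelic L e dV hdV dW hdW v (y : UnitaryGroup.localPi L (IsCMField.complexConj L) (2 + 2) (hermD L e dV hdV dW hdW) v)) : ℂ)) *
              F s (UnitaryGroup.evalPlace (Fp L) L (IsCMField.complexConj L) (2 + 2) (hermD L e dV hdV dW hdW) v
                    (UnitaryGroup.finPart (Fp L) L (IsCMField.complexConj L) (2 + 2) (hermD L e dV hdV dW hdW) (SiegelDoubled.weylDelta L e dV hdV dW hdW)) *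
                (y : UnitaryGroup.localPi L (IsCMField.complexConj L) (2 + 2) (hermD L e dV hdV dW hdW) v) * x) ∂(νv v) = Gn s x) →
        ∀ s : ℂ, dist s z < rb → ∀ h : HA L e dV hdV dW hdW,
          ‖Gn s (UnitaryGroup.evalPlace (Fp L) L (IsCMField.complexConj L) (2 + 2) (hermD L e dV hdV dW hdW) v
              (UnitaryGroup.finPart (Fp L) L (IsCMField.complexConj L) (2 + 2) (hermD L e dV hdV dW hdW) h))‖ ≤
            ((((v.residueCard : ℕ) : ℝ) ^ ((-WithZero.log (Valued.v (algebraMap (Fp L) (v.adicCompletion (Fp L))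
                (gramR L e dV hdV dW hdW 1 1 * Algebra.trace (Fp L) L (σ * imagUnit L))))).toNat + 1)) *
              ∏ w' : UnitaryGroup.PlacesOver L v, (GLn.localHeight (2 + 2) L w'.1 ((h : HA L e dV hdV dW hdW) : GL (Fin (2 + 2)) (AdeleRing (𝓞 L) L)) : ℝ)) ^ Mb) :
    ∃ Gn : skewMatrices ((IsCMField.complexConj L : L ≃ₐ[Fp L] L) : L →+* L) ((gramR L e dV hdV dW hdW).map (algebraMap (Fp L) L)) → Fin m →
        HeightOneSpectrum (𝓞 (Fp L)) → ℂ → HA L e dV hdV dW hdW → ℂ,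
      (∀ S : skewMatrices ((IsCMField.complexConj L : L ≃ₐ[Fp L] L) : L →+* L) ((gramR L e dV hdV dW hdW).map (algebraMap (Fp L) L)),
        (S : Matrix (Fin 2) (Fin 2) L) ≠ 0 → (S : Matrix (Fin 2) (Fin 2) L).det = 0 → ∀ (h : HA L e dV hdV dW hdW) (i : Fin m), ∀ v ∈ T S h,
          ∀ s₀ : ℂ, 0 < s₀.re → IsQRationalRegularAt (v.residueCard) s₀ (fun s => Gn S i v s h)) ∧
      (∀ S : skewMatrices ((IsCMField.complexConj L : L ≃ₐ[Fp L] L) : L →+* L) ((gramR L e dV hdV dW hdW).map (algebraMap (Fp L) L)),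
        (S : Matrix (Fin 2) (Fin 2) L) ≠ 0 → (S : Matrix (Fin 2) (Fin 2) L).det = 0 → ∀ (h : HA L e dV hdV dW hdW) (i : Fin m), ∀ v ∈ T S h,
          ∀ s : ℂ, 1 < s.re → W S i v s h = Gn S i v s h) ∧
      (∀ z : ℂ, 0 < z.re → ∃ (Mv : ℕ) (r : ℝ), 0 < r ∧
        ∀ (S : skewMatrices ((IsCMField.complexConj L : L ≃ₐ[Fp L] L) : L →+* L) ((gramR L e dV hdV dW hdW).map (algebraMap (Fp L) L))) (s : ℂ), dist s z < r →
        ∀ h : HA L e dV hdV dW hdW, (S : Matrix (Fin 2) (Fin 2) L) ≠ 0 → (S : Matrix (Fin 2) (Fin 2) L).det = 0 → ∀ i ∈ (Finset.univ : Finset (Fin m)), ∀ v ∈ T S h,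
          ‖Gn S i v s h‖ ≤ ((((v.residueCard : ℕ) : ℝ) ^ (mτ S v + 1)) *
            ∏ w' : UnitaryGroup.PlacesOver L v, (GLn.localHeight (2 + 2) L w'.1 ((gc S * h : HA L e dV hdV dW hdW) : GL (Fin (2 + 2)) (AdeleRing (𝓞 L) L)) : ℝ)) ^ Mv) := by
  haveI : Algebra.IsQuadraticExtension (Fp L) L := IsCMField.isQuadraticExtension L
  -- the local components of the unitary `χ` are unitary
  have hχ1 : ∀ (v : HeightOneSpectrum (𝓞 (Fp L))) (w : UnitaryGroup.PlacesOver L v) (x : (w.1.adicCompletion L)ˣ), ‖((χ.localComponent w.1 x : ℂˣ) : ℂ)‖ = 1 :=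
    fun v w x => by
      rw [HeckeCharacter.localComponent_apply]
      exact hχu _
  -- each local factor of the reading is a smooth local Siegel section of weight `(χ_v, s)` (as ★ ED. 2)
  have hmem : ∀ (j : Fin m) (v : HeightOneSpectrum (𝓞 (Fp L))) (s : ℂ),
      (fun (j : Fin m) (v : HeightOneSpectrum (𝓞 (Fp L))) (s : ℂ) (y : UnitaryGroup.localPi L (IsCMField.complexConj L) (2 + 2) (hermD L e dV hdV dW hdW) v) =>
          if v ∈ S₀ then ((modDelta L e dV hdV dW hdW (𝒦.pPart (locToAdelic L e dV hdV dW hdW v y)) : ℝ) : ℂ) ^ (2 * (s - s₀)) * b j v y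
          else LambdaLoc L e dV hdV dW hdW v χ s y) j v s ∈
      localDegPS (Fp L) L (IsCMField.complexConj L) (complexConj_imagUnit L) (imagUnit_ne_zero L) (imagUnit_mul_self L)
        v 2 (gramR_isSymm L e dV hdV dW hdW) (hermD_eq_map_gramD L e dV hdV dW hdW) (fun w => χ.localComponent w.1) s := by
    intro j v s
    by_cases hv : v ∈ S₀
    · simp only [hv, if_true]
      exact hb j v hv s
    · simp only [hv, if_false]
      exact lambdaLoc_mem_localDegPS L e dV hdV dW hdW v χ s (hχS₀ v hv)
  -- the cofinite Iwasawa set `T₃` (★ S4-good): off it `H_v = P_Δ(L⁺_v)·K_{H,v}`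
  obtain ⟨T₃, hT₃⟩ : ∃ T₃ : Finset (HeightOneSpectrum (𝓞 (Fp L))), ∀ v ∉ T₃, ∀ x : UnitaryGroup.localPi L (IsCMField.complexConj L) (2 + 2) (hermD L e dV hdV dW hdW) v,
      ∃ p ∈ siegelDeltaLoc L e dV hdV dW hdW v, ∃ k ∈ UnitaryGroup.localInt L (IsCMField.complexConj L) (2 + 2) (hermD L e dV hdV dW hdW) v, x = p * k :=
    ⟨(Filter.eventually_cofinite.1 (eventually_forall_exists_siegelDelta_mul_localInt L e dV hdV hdV0 dW hdW hdW0)).toFinset, fun v hv => by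
      by_contra h1
      exact hv ((Set.Finite.mem_toFinset _).2 h1)⟩
  -- the good-place letter's finite set and its data, chosen once per `z`
  obtain ⟨Tg, hPg⟩ := hPgood
  choose! Mg rg hrg hgood using hPg
  -- the bad set of the T₀-split
  set Bad : Finset (HeightOneSpectrum (𝓞 (Fp L))) := S₀ ∪ T₃ ∪ Tg with hBad
  have hBadS₀ : ∀ {v}, v ∉ Bad → v ∉ S₀ := fun {v} hv h => hv (by rw [hBad]; exact Finset.mem_union_left _ (Finset.mem_union_left _ h))
  have hBadT₃ : ∀ {v}, v ∉ Bad → v ∉ T₃ := fun {v} hv h => hv (by rw [hBad]; exact Finset.mem_union_left _ (Finset.mem_union_right _ h))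
  have hBadTg : ∀ {v}, v ∉ Bad → v ∉ Tg := fun {v} hv h => hv (by rw [hBad]; exact Finset.mem_union_right _ h)
  -- PER `(j, v)`: a σ-indexed family of faces with ★ p863501's two clauses, and ONE growth exponent ∕ radius per `z`, equal to `(Mg, rg)` off `Bad`
  have key : ∀ (j : Fin m) (v : HeightOneSpectrum (𝓞 (Fp L))),
      ∃ (GnF : L → ℂ → UnitaryGroup.localPi L (IsCMField.complexConj L) (2 + 2) (hermD L e dV hdV dW hdW) v → ℂ) (E : ℂ → ℕ) (ρ : ℂ → ℝ),
        (∀ z : ℂ, 0 < z.re → 0 < ρ z) ∧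
        (∀ σ : L, gramR L e dV hdV dW hdW 1 1 * Algebra.trace (Fp L) L (σ * imagUnit L) ≠ 0 →
          (∀ s₁ : ℂ, 0 < s₁.re → ∀ x, IsQRationalRegularAt (residueFieldCard (v.adicCompletion (Fp L))) s₁ (fun s => GnF σ s x)) ∧
          ∀ s : ℂ, 1 < s.re → ∀ x : UnitaryGroup.localPi L (IsCMField.complexConj L) (2 + 2) (hermD L e dV hdV dW hdW) v,
            ∫ y : ↥(unipDeltaLoc L e dV hdV dW hdW v), conj ((unipDeltaChar L e dV hdV dW hdW (Matrix.single 1 1 σ)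
                  (locToAdelic L e dV hdV dW hdW v (y : UnitaryGroup.localPi L (IsCMField.complexConj L) (2 + 2) (hermD L e dV hdV dW hdW) v)) : ℂ)) *
                (fun (j : Fin m) (v : HeightOneSpectrum (𝓞 (Fp L))) (s : ℂ) (y : UnitaryGroup.localPi L (IsCMField.complexConj L) (2 + 2) (hermD L e dV hdV dW hdW) v) =>
                    if v ∈ S₀ then ((modDelta L e dV hdV dW hdW (𝒦.pPart (locToAdelic L e dV hdV dW hdW v y)) : ℝ) : ℂ) ^ (2 * (s - s₀)) * b j v y
                    else LambdaLoc L e dV hdV dW hdW v χ s y) j v s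
                  (UnitaryGroup.evalPlace (Fp L) L (IsCMField.complexConj L) (2 + 2) (hermD L e dV hdV dW hdW) v
                      (UnitaryGroup.finPart (Fp L) L (IsCMField.complexConj L) (2 + 2) (hermD L e dV hdV dW hdW) (SiegelDoubled.weylDelta L e dV hdV dW hdW)) *
                    (y : UnitaryGroup.localPi L (IsCMField.complexConj L) (2 + 2) (hermD L e dV hdV dW hdW) v) * x) ∂(νv v) = GnF σ s x) ∧
        (∀ z : ℂ, 0 < z.re → ∀ σ : L, gramR L e dV hdV dW hdW 1 1 * Algebra.trace (Fp L) L (σ * imagUnit L) ≠ 0 → ∀ s : ℂ, dist s z < ρ z →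
          ∀ h : HA L e dV hdV dW hdW,
            ‖GnF σ s (UnitaryGroup.evalPlace (Fp L) L (IsCMField.complexConj L) (2 + 2) (hermD L e dV hdV dW hdW) v
                (UnitaryGroup.finPart (Fp L) L (IsCMField.complexConj L) (2 + 2) (hermD L e dV hdV dW hdW) h))‖ ≤
              ((((v.residueCard : ℕ) : ℝ) ^ ((-WithZero.log (Valued.v (algebraMap (Fp L) (v.adicCompletion (Fp L))
                  (gramR L e dV hdV dW hdW 1 1 * Algebra.trace (Fp L) L (σ * imagUnit L))))).toNat + 1)) *
                ∏ w' : UnitaryGroup.PlacesOver L v, (GLn.localHeight (2 + 2) L w'.1 ((h : HA L e dV hdV dW hdW) : GL (Fin (2 + 2)) (AdeleRing (𝓞 L) L)) : ℝ)) ^ E z) ∧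
        (v ∉ Bad → E = Mg ∧ ρ = rg) := by
    intro j v
    by_cases hvB : v ∈ Bad
    · /- A BAD PLACE: FILE D's compact open Iwasawa `K₁(v)`; the monomial-flat reading at the height `Hf` (★ ED. 2's two sub-branches); PART 1
         `exists_face_sigmaUniform_of_monomialFlat` (σ-free pieces, ★ p863501 per (piece, σ), `hPbad` per piece, one exponent ∕ radius per `z`). -/
      obtain ⟨K₁, hK₁, hIw₁⟩ := exists_isCompact_isOpen_iwasawa_cm L e dV hdV hdV0 dW hdW hdW0 v
      -- the base `q_v^{ordτ+1}·∏ H_w` dominates `q_v`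
      have hBnd : ∀ (σ : L) (h : HA L e dV hdV dW hdW), ((v.residueCard : ℕ) : ℝ) ≤
          (((v.residueCard : ℕ) : ℝ) ^ ((-WithZero.log (Valued.v (algebraMap (Fp L) (v.adicCompletion (Fp L))
              (gramR L e dV hdV dW hdW 1 1 * Algebra.trace (Fp L) L (σ * imagUnit L))))).toNat + 1)) *
            ∏ w' : UnitaryGroup.PlacesOver L v, (GLn.localHeight (2 + 2) L w'.1 ((h : HA L e dV hdV dW hdW) : GL (Fin (2 + 2)) (AdeleRing (𝓞 L) L)) : ℝ) := by
        intro σ h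
        have hq1 : (1 : ℝ) ≤ ((v.residueCard : ℕ) : ℝ) := by exact_mod_cast (HeightOneSpectrum.one_lt_residueCard v).le
        have hP1 : (1 : ℝ) ≤ ∏ w' : UnitaryGroup.PlacesOver L v, (GLn.localHeight (2 + 2) L w'.1 ((h : HA L e dV hdV dW hdW) : GL (Fin (2 + 2)) (AdeleRing (𝓞 L) L)) : ℝ) :=
          Finset.one_le_prod fun w' _ => by exact_mod_cast GLn.one_le_localHeight (n := 2 + 2) (K := L) w'.1 ((h : HA L e dV hdV dW hdW) : GL (Fin (2 + 2)) (AdeleRing (𝓞 L) L))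
        calc ((v.residueCard : ℕ) : ℝ) = ((v.residueCard : ℕ) : ℝ) ^ 1 * 1 := by rw [pow_one, mul_one]
          _ ≤ _ := mul_le_mul (pow_le_pow_right₀ hq1 (Nat.le_add_left 1 _)) hP1 zero_le_one (pow_nonneg (zero_le_one.trans hq1) _)
      by_cases hv : v ∈ S₀
      · -- ABOVE `S₀`: `Hf := H_{𝒦,v}` ((f1) ★ `modDelta_pos`, (f2ᴷ) ★ `K2LiuSiegelModulusCompact` §3, (f3) ★ `heightLoc_mul_of_mem`, (f4) ★ FILE A, `hG` by `H^0 = 1`)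
        obtain ⟨GnF, E, ρ, hρ, hfaceσ, hgr⟩ := exists_face_sigmaUniform_of_monomialFlat L e dV hdV hdV0 dW hdW hdW0 v (νv v) (fun w => χ.localComponent w.1) (hχ1 v)
          K₁ hK₁ hIw₁ _ (fun s => (hmem j v s).1) (fun s => (hmem j v s).2)
          (fun u => modDelta L e dV hdV dW hdW (𝒦.pPart (locToAdelic L e dV hdV dW hdW v u))) (fun u => modDelta_pos L e dV hdV dW hdW _)
          (heightLoc_siegel_mul_of_isSiegelDelta_of_mem_compact L e dV hdV hdV0 dW hdW hdW0 v 𝒦 K₁ hK₁.1)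
          ⟨(𝒦.K).comap (locToAdelic L e dV hdV dW hdW v), isOpen_coe_comap_locToAdelic L e dV hdV dW hdW v h𝒦⟩
          (fun u k hk => heightLoc_mul_of_mem L e dV hdV hdV0 dW hdW hdW0 v 𝒦 u (Subgroup.mem_comap.1 hk))
          (fun u => exists_heightLoc_sq_eq_qpow L e dV hdV hdV0 dW hdW hdW0 h𝒦 v u) s₀
          (fun s u => by simp only [hv, if_true, sub_self, mul_zero, Complex.cpow_zero, one_mul])
          (fun h : HA L e dV hdV dW hdW => UnitaryGroup.evalPlace (Fp L) L (IsCMField.complexConj L) (2 + 2) (hermD L e dV hdV dW hdW) v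
            (UnitaryGroup.finPart (Fp L) L (IsCMField.complexConj L) (2 + 2) (hermD L e dV hdV dW hdW) h)) _ hBnd (hPbad v K₁ hK₁ hIw₁)
        exact ⟨GnF, E, ρ, hρ, hfaceσ, hgr, fun hvB' => absurd hvB hvB'⟩
      · -- OFF `S₀`: the TOTAL height of ★ FILE A′ `exists_height_lambdaLoc_reading'` ((f2ᴷ) on the compact `K₁`, (f3) on the open `K_{H,v}`, the reading for all `s, u`)
        obtain ⟨Hf, hf1, hf2, -, -, hf3, hf4, -, hread⟩ := exists_height_lambdaLoc_reading' L e dV hdV hdV0 dW hdW hdW0 v χ (hχS₀ v hv) s₀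
        obtain ⟨GnF, E, ρ, hρ, hfaceσ, hgr⟩ := exists_face_sigmaUniform_of_monomialFlat L e dV hdV hdV0 dW hdW hdW0 v (νv v) (fun w => χ.localComponent w.1) (hχ1 v)
          K₁ hK₁ hIw₁ _ (fun s => (hmem j v s).1) (fun s => (hmem j v s).2) Hf hf1
          (fun p hp hpK u => hf2 K₁ hK₁.1 p ((mem_siegelDeltaLoc_iff_local L e dV hdV dW hdW v p).2 hp) hpK u)
          ⟨UnitaryGroup.localInt L (IsCMField.complexConj L) (2 + 2) (hermD L e dV hdV dW hdW) v,
            UnitaryGroup.isOpen_localInt L (IsCMField.complexConj L) (2 + 2) (hermD L e dV hdV dW hdW) v⟩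
          (fun u k hk => hf3 u k hk) hf4 s₀
          (fun s u => by
            simp only [hv, if_false]
            exact hread s u)
          (fun h : HA L e dV hdV dW hdW => UnitaryGroup.evalPlace (Fp L) L (IsCMField.complexConj L) (2 + 2) (hermD L e dV hdV dW hdW) v
            (UnitaryGroup.finPart (Fp L) L (IsCMField.complexConj L) (2 + 2) (hermD L e dV hdV dW hdW) h)) _ hBnd (hPbad v K₁ hK₁ hIw₁)
        exact ⟨GnF, E, ρ, hρ, hfaceσ, hgr, fun hvB' => absurd hvB hvB'⟩
    · /- A GOOD PLACE (`v ∉ S₀ ∪ T₃ ∪ Tg`): `K₀ := K_{H,v}` (compact open, Iwasawa off `T₃`); the reading is `Λ_{s,v}`, FLAT ON `K_{H,v}` ITSELF (★ FILE A′ (f5) + the reading);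
         ★ p863501 directly (one piece); growth by `hPgood` with the uniform `(Mg, rg)`. -/
      have hvS₀ : v ∉ S₀ := hBadS₀ hvB
      have hIwH : ∀ g : UnitaryGroup.localPi L (IsCMField.complexConj L) (2 + 2) (hermD L e dV hdV dW hdW) v,
          ∃ p, IsSiegelDelta (Fp L) L (IsCMField.complexConj L) (complexConj_imagUnit L) (imagUnit_ne_zero L) (imagUnit_mul_self L)
            v 2 (gramR_isSymm L e dV hdV dW hdW) (hermD_eq_map_gramD L e dV hdV dW hdW) p ∧
            ∃ k ∈ UnitaryGroup.localInt L (IsCMField.complexConj L) (2 + 2) (hermD L e dV hdV dW hdW) v, g = p * k := fun g => by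
        obtain ⟨p, hp, k, hk, hg⟩ := hT₃ v (hBadT₃ hvB) g
        exact ⟨p, (mem_siegelDeltaLoc_iff_local L e dV hdV dW hdW v p).1 hp, k, hk, hg⟩
      have hKH : IsCompact (UnitaryGroup.localInt L (IsCMField.complexConj L) (2 + 2) (hermD L e dV hdV dW hdW) v :
            Set (UnitaryGroup.localPi L (IsCMField.complexConj L) (2 + 2) (hermD L e dV hdV dW hdW) v)) ∧
          IsOpen (UnitaryGroup.localInt L (IsCMField.complexConj L) (2 + 2) (hermD L e dV hdV dW hdW) v :
            Set (UnitaryGroup.localPi L (IsCMField.complexConj L) (2 + 2) (hermD L e dV hdV dW hdW) v)) :=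
        ⟨UnitaryGroup.isCompact_localInt L (IsCMField.complexConj L) (2 + 2) (hermD L e dV hdV dW hdW) v,
          UnitaryGroup.isOpen_localInt L (IsCMField.complexConj L) (2 + 2) (hermD L e dV hdV dW hdW) v⟩
      -- flatness of the reading `Λ` on `K_{H,v}` (★ FILE A′: (f5) `Hf = 1` there, and `Λ_s = Hf^{2(s−s₀)}·Λ_{s₀}`)
      obtain ⟨Hf, -, -, -, -, -, -, hf5, hread⟩ := exists_height_lambdaLoc_reading' L e dV hdV hdV0 dW hdW hdW0 v χ (hχS₀ v hvS₀) s₀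
      have hflat : ∀ s s' : ℂ, ∀ k ∈ UnitaryGroup.localInt L (IsCMField.complexConj L) (2 + 2) (hermD L e dV hdV dW hdW) v,
          (fun (j : Fin m) (v : HeightOneSpectrum (𝓞 (Fp L))) (s : ℂ) (y : UnitaryGroup.localPi L (IsCMField.complexConj L) (2 + 2) (hermD L e dV hdV dW hdW) v) =>
              if v ∈ S₀ then ((modDelta L e dV hdV dW hdW (𝒦.pPart (locToAdelic L e dV hdV dW hdW v y)) : ℝ) : ℂ) ^ (2 * (s - s₀)) * b j v y
              else LambdaLoc L e dV hdV dW hdW v χ s y) j v s k =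
          (fun (j : Fin m) (v : HeightOneSpectrum (𝓞 (Fp L))) (s : ℂ) (y : UnitaryGroup.localPi L (IsCMField.complexConj L) (2 + 2) (hermD L e dV hdV dW hdW) v) =>
              if v ∈ S₀ then ((modDelta L e dV hdV dW hdW (𝒦.pPart (locToAdelic L e dV hdV dW hdW v y)) : ℝ) : ℂ) ^ (2 * (s - s₀)) * b j v y
              else LambdaLoc L e dV hdV dW hdW v χ s y) j v s' k := by
        intro s s' k hk
        simp only [hvS₀, if_false]
        rw [hread s k, hread s' k, hf5 k hk, Complex.ofReal_one, Complex.one_cpow, Complex.one_cpow]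
      -- ★ p863501 per σ (guarded)
      have hface : ∀ σ : L, ∃ Gn : ℂ → UnitaryGroup.localPi L (IsCMField.complexConj L) (2 + 2) (hermD L e dV hdV dW hdW) v → ℂ,
          gramR L e dV hdV dW hdW 1 1 * Algebra.trace (Fp L) L (σ * imagUnit L) ≠ 0 →
          (∀ s₁ : ℂ, 0 < s₁.re → ∀ x, IsQRationalRegularAt (residueFieldCard (v.adicCompletion (Fp L))) s₁ (fun s => Gn s x)) ∧
          ∀ s : ℂ, 1 < s.re → ∀ x : UnitaryGroup.localPi L (IsCMField.complexConj L) (2 + 2) (hermD L e dV hdV dW hdW) v,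
            ∫ y : ↥(unipDeltaLoc L e dV hdV dW hdW v), conj ((unipDeltaChar L e dV hdV dW hdW (Matrix.single 1 1 σ)
                  (locToAdelic L e dV hdV dW hdW v (y : UnitaryGroup.localPi L (IsCMField.complexConj L) (2 + 2) (hermD L e dV hdV dW hdW) v)) : ℂ)) *
                (fun (j : Fin m) (v : HeightOneSpectrum (𝓞 (Fp L))) (s : ℂ) (y : UnitaryGroup.localPi L (IsCMField.complexConj L) (2 + 2) (hermD L e dV hdV dW hdW) v) =>
                    if v ∈ S₀ then ((modDelta L e dV hdV dW hdW (𝒦.pPart (locToAdelic L e dV hdV dW hdW v y)) : ℝ) : ℂ) ^ (2 * (s - s₀)) * b j v y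
                    else LambdaLoc L e dV hdV dW hdW v χ s y) j v s
                  (UnitaryGroup.evalPlace (Fp L) L (IsCMField.complexConj L) (2 + 2) (hermD L e dV hdV dW hdW) v
                      (UnitaryGroup.finPart (Fp L) L (IsCMField.complexConj L) (2 + 2) (hermD L e dV hdV dW hdW) (SiegelDoubled.weylDelta L e dV hdV dW hdW)) *
                    (y : UnitaryGroup.localPi L (IsCMField.complexConj L) (2 + 2) (hermD L e dV hdV dW hdW) v) * x) ∂(νv v) = Gn s x := by
        intro σ
        by_cases hσ : gramR L e dV hdV dW hdW 1 1 * Algebra.trace (Fp L) L (σ * imagUnit L) ≠ 0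
        · obtain ⟨Gn, h1, h2⟩ := exists_localFace_kindOneSingular L e dV hdV hdV0 dW hdW hdW0 v (νv v) (fun w => χ.localComponent w.1) (hχ1 v)
            (UnitaryGroup.localInt L (IsCMField.complexConj L) (2 + 2) (hermD L e dV hdV dW hdW) v) hKH hIwH _
            (fun s => (hmem j v s).1) (fun s => (hmem j v s).2) hflat σ hσ
          exact ⟨Gn, fun _ => ⟨h1, h2⟩⟩
        · exact ⟨fun _ _ => 0, fun h => absurd h hσ⟩
      choose GnF hGnF using hface
      refine ⟨GnF, Mg, rg, hrg, hGnF, fun z hz σ hσ s hs h => ?_, fun _ => ⟨rfl, rfl⟩⟩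
      -- GROWTH at a good place: `hPgood`, reading the (G2) clause with `Λ` literal
      refine hgood z hz v (hBadTg hvB) σ hσ (GnF σ) (hGnF σ hσ).1 (fun s' hs' x => ?_) s hs h
      have h2 := (hGnF σ hσ).2 s' hs' x
      simp only [hvS₀, if_false] at h2
      exact h2
  choose GnF E ρ hρ hface hgrow hgoodE using key
  refine ⟨fun S j v s h => GnF j v (σc S) s (UnitaryGroup.evalPlace (Fp L) L (IsCMField.complexConj L) (2 + 2) (hermD L e dV hdV dW hdW) v
      (UnitaryGroup.finPart (Fp L) L (IsCMField.complexConj L) (2 + 2) (hermD L e dV hdV dW hdW) (gc S * h))),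
    fun S hS0 hSd h i v _ s₁ hs₁ => ?_, fun S hS0 hSd h i v _ s hs => ?_, fun z hz => ?_⟩
  · -- `hGn`: ★ p863501's regularity, base `residueFieldCard (L⁺_v) = q_v`
    have h1 := (hface i v (σc S) (hτ S hS0 hSd)).1 s₁ hs₁ (UnitaryGroup.evalPlace (Fp L) L (IsCMField.complexConj L) (2 + 2) (hermD L e dV hdV dW hdW) v
      (UnitaryGroup.finPart (Fp L) L (IsCMField.complexConj L) (2 + 2) (hermD L e dV hdV dW hdW) (gc S * h)))
    rwa [residueFieldCard_adicCompletion_eq (Fp L) v] at h1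
  · -- `hW`: the witness equation, then the integral identity at the translate `(gc S·h)_v`
    rw [hWeq]
    exact (hface i v (σc S) (hτ S hS0 hSd)).2 s hs _
  · -- `hGnv`: ONE exponent `Mv := max (Mg z) (max over Bad × Fin m of E)`, ONE radius below `rg z` and the bad radii
    obtain ⟨r, hr, -, hrle⟩ := exists_pos_le_one_forall_le (insert (rg z) ((Bad ×ˢ (Finset.univ : Finset (Fin m))).image fun p => ρ p.2 p.1 z)) id
      (fun x hx => by
        rcases Finset.mem_insert.1 hx with rfl | hx
        · exact hrg z hz
        · obtain ⟨p, -, rfl⟩ := Finset.mem_image.1 hx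
          exact hρ p.2 p.1 z hz)
    refine ⟨max (Mg z) (Bad.sup fun v => (Finset.univ : Finset (Fin m)).sup fun j => E j v z), r, hr, fun S s hs h hS0 hSd i _ v _ => ?_⟩
    -- the exponent and the radius of `(i, v)` against the uniform ones
    have hE : E i v z ≤ max (Mg z) (Bad.sup fun v => (Finset.univ : Finset (Fin m)).sup fun j => E j v z) := by
      by_cases hvB : v ∈ Bad
      · refine le_trans ?_ (le_max_right _ _)
        exact le_trans (Finset.le_sup (f := fun j => E j v z) (Finset.mem_univ i)) (Finset.le_sup (f := fun v => (Finset.univ : Finset (Fin m)).sup fun j => E j v z) hvB)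
      · rw [(hgoodE i v hvB).1]
        exact le_max_left _ _
    have hρr : r ≤ ρ i v z := by
      by_cases hvB : v ∈ Bad
      · exact hrle _ (Finset.mem_insert_of_mem (Finset.mem_image.2 ⟨(v, i), Finset.mem_product.2 ⟨hvB, Finset.mem_univ i⟩, rfl⟩))
      · rw [(hgoodE i v hvB).2]
        exact hrle _ (Finset.mem_insert_self _ _)
    have hq1 : (1 : ℝ) ≤ ((v.residueCard : ℕ) : ℝ) := by exact_mod_cast (HeightOneSpectrum.one_lt_residueCard v).le
    have hP1 : (1 : ℝ) ≤ ∏ w' : UnitaryGroup.PlacesOver L v, (GLn.localHeight (2 + 2) L w'.1 ((gc S * h : HA L e dV hdV dW hdW) : GL (Fin (2 + 2)) (AdeleRing (𝓞 L) L)) : ℝ) :=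
      Finset.one_le_prod fun w' _ => by exact_mod_cast GLn.one_le_localHeight (n := 2 + 2) (K := L) w'.1 ((gc S * h : HA L e dV hdV dW hdW) : GL (Fin (2 + 2)) (AdeleRing (𝓞 L) L))
    have hB1 : (1 : ℝ) ≤ (((v.residueCard : ℕ) : ℝ) ^ (mτ S v + 1)) *
        ∏ w' : UnitaryGroup.PlacesOver L v, (GLn.localHeight (2 + 2) L w'.1 ((gc S * h : HA L e dV hdV dW hdW) : GL (Fin (2 + 2)) (AdeleRing (𝓞 L) L)) : ℝ) :=
      one_le_mul_of_one_le_of_one_le (one_le_pow₀ hq1) hP1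
    have hg := hgrow i v z hz (σc S) (hτ S hS0 hSd) s (lt_of_lt_of_le hs hρr) (gc S * h)
    rw [← hmτ S v] at hg
    exact hg.trans (pow_le_pow_right₀ hB1 hE)

end Head

end Summit.HodgeConjecture.HodgeConjecture.Cruxes.HLiu418.K2LiuKindOneSingularLocalFaceOfRecordEdThree
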